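import Mathlib
import HarnessLib
import Literature.NumberTheory.LFunctions.ZetaScrew
import Summits.RiemannHypothesis.RiemannHypothesis.Theorems.IntegerScrewDefs
import Summits.RiemannHypothesis.RiemannHypothesis.Theorems.IntegerScrewNestedSylvester
import Summits.RiemannHypothesis.RiemannHypothesis.Theorems.IntegerScrewPivotCriterion
import Summits.RiemannHypothesis.RiemannHypothesis.Theorems.IntegerScrewPivotUpperBound
import Summits.RiemannHypothesis.RiemannHypothesis.Theorems.PfPersistenceHalfLineBiasScrew

/-!
# Route `IntegerScrew` — the LEADING TERM as a bound: `2Ψ(h) ≤ h·log(1/h) + 4h` on the wall, hence `d_M ≤ (log M + 4)/(M − 1)`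

The identified leading term of the pivot law (HOME/pivot/PIVOT-LAW.md §1/§2a: `M·d_M = L(M) − G(M)`,
`L(M) = M·2Ψ(log(M/(M−1))) = log M − c₀ + o(1)`) as a kernel-checked UPPER BOUND. On the prime-free
wall `0 < t < log 2` Suzuki's screw function is
`Ψ(t) = 4(e^{t/2} + e^{−t/2} − 2) − (t/2)κ + ¼(C − e^{−t/2}Φ(e^{−2t},2,¼))`
(`zetaScrew_eq_of_abs_lt_log_two`; `κ = γ₀ + π/2 + 3 log 2 + log π`, `C = ζ(2,¼)`). Elementary estimates
(`|eˣ − 1 − x| ≤ x²`; `1 − e^{−x} ≤ x`; `C ≤ 18` from `ζ(2) = π²/6`; `κ ≥ 5` reused from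
`PfPersistenceHalfLineBiasScrew.five_le_screwSlope`; and the split of
`C − Φ = Σ_k (1 − e^{−2tk})(k+¼)^{−2}` at `k ≈ 1/t` with the harmonic bound `H_n ≤ 1 + log n` below and
`Σ_{i>k} i^{−2} ≤ 2/(k+1)` above) give

* `tsum_one_div_nat_add_quarter_sq_le` : `C = Σ_{k≥0} (k+¼)^{−2} ≤ 18`;
* `sub_hurwitzLerchQuarter_le` : `C − Φ(e^{−2t},2,¼) ≤ 2t·log(1/t) + 4t` for `0 < t ≤ 1`;
* **`two_zetaScrew_le_log`** : `2Ψ(t) ≤ t·log(1/t) + 4t` for `0 < t ≤ 1/2`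
  (the true expansion is `t log(1/t) − 1.415…·t + O(t²)`; only the leading term is sharp here);
* **`screwPivot_le_log_div`** : `d_M ≤ (log M + 4)/(M − 1)` for every `M ≥ 3` with `S_{M−1} ≻ 0`
  (via `screwPivot_le_two_zetaScrew_log_div`, `h_M = log(M/(M−1)) ∈ [1/M, 1/(M−1)]`), along certified
  ladders (`…_of_ladder`) and for all `M ≥ 3` under RH (`…_of_riemannHypothesis`).

So under RH the pivots satisfy `0 < d_M ≤ (log M + 4)/(M−1)`: the margin by which the RH-equivalent
positivity `d_M > 0` holds tends to zero at least like `log M / M`. Nothing here is progress on `ζ`: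
the wall formula is prime-free and the rest is calculus. Reference: M. Suzuki, J. Lond. Math. Soc. (2)
108 (2023) = arXiv:2206.03682, (1.1) and the proof of Thm 4.1 (the wall) [Suzuki2023].
-/

noncomputable section

-- D-0017: `Summit.<S>.<S>.…` is the designed namespace of a single-problem summit.
set_option linter.dupNamespace false

namespace Summit.RiemannHypothesis.RiemannHypothesis.Theorems.IntegerScrew

open Literature.NumberTheory.LFunctions Finset
open scoped BigOperators

/-! ### Elementary constants -/

/-- `C = ζ(2,¼) = Σ_{k≥0} (k+¼)^{−2} ≤ 18` (`= 16 + Σ_{k≥1}(k+¼)^{−2} ≤ 16 + π²/6`; true value `17.197…`).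
[folklore] -/
theorem tsum_one_div_nat_add_quarter_sq_le :
    ∑' k : ℕ, 1 / ((k : ℝ) + 1 / 4) ^ 2 ≤ 18 := by
  have hs := summable_one_div_nat_add_quarter_sq
  rw [hs.tsum_eq_zero_add]
  have h0 : (1 : ℝ) / (((0 : ℕ) : ℝ) + 1 / 4) ^ 2 = 16 := by norm_num
  have hz : HasSum (fun n : ℕ => (1 : ℝ) / (n : ℝ) ^ 2) (Real.pi ^ 2 / 6) := hasSum_zeta_two
  have hz1 : ∑' n : ℕ, (1 : ℝ) / ((n + 1 : ℕ) : ℝ) ^ 2 = Real.pi ^ 2 / 6 := by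
    have h := hz.summable.tsum_eq_zero_add
    rw [hz.tsum_eq] at h
    simp only [Nat.cast_zero, ne_eq, OfNat.ofNat_ne_zero, not_false_eq_true, zero_pow, div_zero,
      zero_add] at h
    exact h.symm
  have hs1 : Summable fun n : ℕ => (1 : ℝ) / ((n + 1 : ℕ) : ℝ) ^ 2 :=
    (summable_nat_add_iff 1).mpr hz.summable
  have htail : ∑' k : ℕ, 1 / (((k + 1 : ℕ) : ℝ) + 1 / 4) ^ 2 ≤ Real.pi ^ 2 / 6 := by
    rw [← hz1]
    refine Summable.tsum_le_tsum (fun k => ?_) ((summable_nat_add_iff 1).mpr hs) hs1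
    have hk : (0 : ℝ) < ((k + 1 : ℕ) : ℝ) := by positivity
    apply one_div_le_one_div_of_le (by positivity)
    nlinarith
  have hpi : Real.pi ^ 2 / 6 ≤ 2 := by
    have := Real.pi_lt_d2
    nlinarith [Real.pi_pos]
  linarith

/-! ### The Hurwitz–Lerch term near `t = 0` -/

/-- HEAD of the split: `Σ_{k<J+1} 2tk/(k+¼)² ≤ 2t(1 + log J)` for `t ≥ 0`
(`k/(k+¼)² ≤ 1/k` and `H_J ≤ 1 + log J`; `log 0 = 0` covers `J = 0`). [folklore] -/
theorem sum_head_le {t : ℝ} (ht : 0 ≤ t) (J : ℕ) :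
    ∑ k ∈ range (J + 1), 2 * t * (k : ℝ) / ((k : ℝ) + 1 / 4) ^ 2 ≤ 2 * t * (1 + Real.log J) := by
  rw [sum_range_succ']
  simp only [Nat.cast_zero, mul_zero, zero_div, add_zero, Nat.cast_add, Nat.cast_one]
  have hterm : ∀ i ∈ range J,
      2 * t * ((i : ℝ) + 1) / ((i : ℝ) + 1 + 1 / 4) ^ 2 ≤ 2 * t * (1 / ((i : ℝ) + 1)) := by
    intro i _
    have hi : (0 : ℝ) < (i : ℝ) + 1 := by positivity
    rw [div_le_iff₀ (by positivity)]
    have : 2 * t * (1 / ((i : ℝ) + 1)) * ((i : ℝ) + 1 + 1 / 4) ^ 2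
        = 2 * t * ((i : ℝ) + 1) * (((i : ℝ) + 1 + 1 / 4) ^ 2 / ((i : ℝ) + 1) ^ 2) := by
      field_simp
    rw [this]
    have hge : 1 ≤ ((i : ℝ) + 1 + 1 / 4) ^ 2 / ((i : ℝ) + 1) ^ 2 := by
      rw [le_div_iff₀ (by positivity)]
      nlinarith
    have h0 : 0 ≤ 2 * t * ((i : ℝ) + 1) := by positivity
    nlinarith
  calc ∑ i ∈ range J, 2 * t * ((i : ℝ) + 1) / ((i : ℝ) + 1 + 1 / 4) ^ 2
      ≤ ∑ i ∈ range J, 2 * t * (1 / ((i : ℝ) + 1)) := sum_le_sum hterm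
    _ = 2 * t * ((harmonic J : ℚ) : ℝ) := by
        have hH : ∀ n : ℕ, ((harmonic n : ℚ) : ℝ) = ∑ i ∈ range n, 1 / ((i : ℝ) + 1) := by
          intro n
          induction n with
          | zero => simp
          | succ n ih =>
            rw [harmonic_succ, sum_range_succ, Rat.cast_add, ih]
            push_cast
            ring
        rw [hH J, mul_sum]
    _ ≤ 2 * t * (1 + Real.log J) := by
        have := harmonic_le_one_add_log J
        exact mul_le_mul_of_nonneg_left this (by positivity)

/-- TAIL of the split: `Σ_{J+1 ≤ k < N} (k+¼)^{−2} ≤ 2/(J+1)` (compare with `Σ_{k>J} k^{−2} ≤ 2/(J+1)`,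
`sum_Ioo_inv_sq_le`). [folklore] -/
theorem sum_tail_le (J N : ℕ) :
    ∑ k ∈ Ico (J + 1) N, 1 / ((k : ℝ) + 1 / 4) ^ 2 ≤ 2 / ((J : ℝ) + 1) := by
  have hsub : Ico (J + 1) N ⊆ Ioo J N := by
    intro k hk
    simp only [mem_Ico] at hk
    simp only [mem_Ioo]
    omega
  calc ∑ k ∈ Ico (J + 1) N, 1 / ((k : ℝ) + 1 / 4) ^ 2
      ≤ ∑ k ∈ Ioo J N, 1 / ((k : ℝ) + 1 / 4) ^ 2 :=
        sum_le_sum_of_subset_of_nonneg hsub fun k _ _ => by positivity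
    _ ≤ ∑ k ∈ Ioo J N, ((k : ℝ) ^ 2)⁻¹ := by
        refine sum_le_sum fun k hk => ?_
        simp only [mem_Ioo] at hk
        have hk1 : (1 : ℝ) ≤ (k : ℝ) := by exact_mod_cast (show 1 ≤ k by omega)
        rw [one_div]
        apply inv_anti₀ (by positivity)
        nlinarith
    _ ≤ 2 / ((J : ℝ) + 1) := sum_Ioo_inv_sq_le J N

/-- `C − Φ(e^{−2t}, 2, ¼) = Σ_{k≥0} (1 − e^{−2tk})(k+¼)^{−2} ≤ 2t·log(1/t) + 4t` for `0 < t ≤ 1`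
(split the series at `k = ⌊1/t⌋`: `1 − e^{−2tk} ≤ 2tk` below, `≤ 1` above). [folklore] -/
theorem sub_hurwitzLerchQuarter_le {t : ℝ} (ht : 0 < t) (ht1 : t ≤ 1) :
    (∑' k : ℕ, 1 / ((k : ℝ) + 1 / 4) ^ 2) - hurwitzLerchQuarter t
      ≤ 2 * t * Real.log (1 / t) + 4 * t := by
  have hs := summable_one_div_nat_add_quarter_sq
  have hsΦ := summable_hurwitzLerchQuarter t
  -- the difference as one series of non-negative terms
  set u : ℕ → ℝ := fun k => (1 - Real.exp (-(2 * |t| * k))) / ((k : ℝ) + 1 / 4) ^ 2 with hu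
  have hdiff : (∑' k : ℕ, 1 / ((k : ℝ) + 1 / 4) ^ 2) - hurwitzLerchQuarter t = ∑' k, u k := by
    rw [hurwitzLerchQuarter, ← hs.tsum_sub hsΦ]
    refine tsum_congr fun k => ?_
    rw [hu]
    ring
  rw [hdiff]
  have habs : |t| = t := abs_of_pos ht
  have hexp_le : ∀ k : ℕ, 1 - Real.exp (-(2 * |t| * k)) ≤ 2 * t * k := by
    intro k
    have := Real.add_one_le_exp (-(2 * |t| * k))
    rw [habs] at this ⊢
    linarith
  have hexp_le_one : ∀ k : ℕ, 1 - Real.exp (-(2 * |t| * k)) ≤ 1 := fun k => by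
    linarith [Real.exp_pos (-(2 * |t| * k))]
  have hu_nonneg : ∀ k, 0 ≤ u k := fun k => by
    rw [hu]
    apply div_nonneg _ (by positivity)
    rw [sub_nonneg, Real.exp_le_one_iff]
    have : 0 ≤ 2 * |t| * k := by positivity
    linarith
  -- split point
  set J : ℕ := ⌊1 / t⌋₊ with hJ
  have hJ1 : 1 ≤ J := by
    rw [hJ]
    exact Nat.one_le_floor_iff _ |>.mpr (by rw [one_div]; exact one_le_inv_iff₀.mpr ⟨ht, ht1⟩)
  have hJle : (J : ℝ) ≤ 1 / t := Nat.floor_le (by positivity)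
  have hJlt : 1 / t < (J : ℝ) + 1 := Nat.lt_floor_add_one _
  apply Real.tsum_le_of_sum_range_le hu_nonneg
  intro n
  -- extend the range to max n (J+1) and split at J+1
  have hsplit : ∑ i ∈ range n, u i ≤
      ∑ i ∈ range (J + 1), u i + ∑ i ∈ Ico (J + 1) (max n (J + 1)), u i := by
    rw [range_eq_Ico, range_eq_Ico,
      ← sum_union (Ico_disjoint_Ico_consecutive 0 (J + 1) (max n (J + 1))),
      Ico_union_Ico_eq_Ico (Nat.zero_le _) (le_max_right _ _)]
    exact sum_le_sum_of_subset_of_nonneg (Ico_subset_Ico_right (le_max_left _ _))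
      fun i _ _ => hu_nonneg i
  have hhead : ∑ i ∈ range (J + 1), u i ≤ 2 * t * (1 + Real.log J) := by
    refine le_trans (sum_le_sum fun k _ => ?_) (sum_head_le ht.le J)
    rw [hu]
    exact div_le_div_of_nonneg_right (hexp_le k) (by positivity)
  have htail : ∑ i ∈ Ico (J + 1) (max n (J + 1)), u i ≤ 2 / ((J : ℝ) + 1) := by
    refine le_trans (sum_le_sum fun k _ => ?_) (sum_tail_le J (max n (J + 1)))
    rw [hu]
    exact div_le_div_of_nonneg_right (hexp_le_one k) (by positivity)
  -- numeric consequences of the split point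
  have hlogJ : Real.log J ≤ Real.log (1 / t) := by
    apply Real.log_le_log _ hJle
    exact_mod_cast hJ1
  have htail' : 2 / ((J : ℝ) + 1) ≤ 2 * t := by
    rw [div_le_iff₀ (by positivity)]
    have : 1 / t * t = 1 := by field_simp
    nlinarith
  have hlog_nonneg : 0 ≤ Real.log (1 / t) := Real.log_nonneg (by
    rw [le_div_iff₀ ht]; linarith)
  calc ∑ i ∈ range n, u i
      ≤ 2 * t * (1 + Real.log J) + 2 / ((J : ℝ) + 1) := le_trans hsplit (add_le_add hhead htail)
    _ ≤ 2 * t * (1 + Real.log (1 / t)) + 2 * t := by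
        have := mul_le_mul_of_nonneg_left (add_le_add_left hlogJ 1) (show 0 ≤ 2 * t by positivity)
        linarith
    _ = 2 * t * Real.log (1 / t) + 4 * t := by ring

/-! ### The bound on `Ψ` -/

/-- Archimedean part: `4(e^{t/2} + e^{−t/2} − 2) ≤ 2t²` for `|t| ≤ 1`. [folklore] -/
theorem archimedean_le_sq {t : ℝ} (ht : |t| ≤ 1) :
    4 * (Real.exp (|t| / 2) + Real.exp (-(|t| / 2)) - 2) ≤ 2 * t ^ 2 := by
  have h1 : |(|t| / 2)| ≤ 1 := by
    rw [abs_div, abs_abs, abs_two]; linarith [abs_nonneg t]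
  have h2 : |(-(|t| / 2))| ≤ 1 := by rwa [abs_neg]
  have e1 := (abs_le.mp (Real.abs_exp_sub_one_sub_id_le h1)).2
  have e2 := (abs_le.mp (Real.abs_exp_sub_one_sub_id_le h2)).2
  have hsq : |t| ^ 2 = t ^ 2 := sq_abs t
  nlinarith

/-- **`2Ψ(t) ≤ t·log(1/t) + 4t` for `0 < t ≤ ½`** (prime-free wall; the expansion
`2Ψ(t) = t log(1/t) − (log 2π + γ₀ − 1)t + O(t²)` shows the leading term is sharp). [folklore] -/
theorem two_zetaScrew_le_log {t : ℝ} (ht : 0 < t) (ht2 : t ≤ 1 / 2) :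
    2 * zetaScrew t ≤ t * Real.log (1 / t) + 4 * t := by
  have habs : |t| = t := abs_of_pos ht
  have hlt : |t| < Real.log 2 := by
    rw [habs]; have := Real.log_two_gt_d9; linarith
  rw [zetaScrew_eq_of_abs_lt_log_two hlt, habs]
  have hA := archimedean_le_sq (show |t| ≤ 1 by rw [habs]; linarith)
  rw [habs] at hA
  have hκ := Summit.RiemannHypothesis.RiemannHypothesis.Theorems.PfPersistenceHalfLineBiasScrew.five_le_screwSlope
  have hC := tsum_one_div_nat_add_quarter_sq_le
  have hΦ0 := hurwitzLerchQuarter_nonneg t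
  have hΦC := hurwitzLerchQuarter_le t
  have hL := sub_hurwitzLerchQuarter_le ht (by linarith)
  have hexp : 1 - Real.exp (-(t / 2)) ≤ t / 2 := by
    have := Real.add_one_le_exp (-(t / 2)); linarith
  have hexp1 : Real.exp (-(t / 2)) ≤ 1 := by
    rw [Real.exp_le_one_iff]; linarith
  have hlog_nonneg : 0 ≤ Real.log (1 / t) := Real.log_nonneg (by
    rw [le_div_iff₀ ht]; linarith)
  -- C − e^{−t/2}Φ = (C − Φ) + (1 − e^{−t/2})Φ ≤ (2t log(1/t) + 4t) + (t/2)·18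
  have hmix : (∑' k : ℕ, 1 / ((k : ℝ) + 1 / 4) ^ 2) - Real.exp (-(t / 2)) * hurwitzLerchQuarter t
      ≤ 2 * t * Real.log (1 / t) + 4 * t + t / 2 * 18 := by
    have h1 : (1 - Real.exp (-(t / 2))) * hurwitzLerchQuarter t ≤ t / 2 * 18 :=
      mul_le_mul hexp (le_trans hΦC hC) hΦ0 (by linarith)
    have h2 : (∑' k : ℕ, 1 / ((k : ℝ) + 1 / 4) ^ 2) - Real.exp (-(t / 2)) * hurwitzLerchQuarter t
        = ((∑' k : ℕ, 1 / ((k : ℝ) + 1 / 4) ^ 2) - hurwitzLerchQuarter t)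
          + (1 - Real.exp (-(t / 2))) * hurwitzLerchQuarter t := by ring
    rw [h2]
    linarith
  have hκt : t / 2 * 5 ≤
      t / 2 * (Real.eulerMascheroniConstant + Real.pi / 2 + 3 * Real.log 2 + Real.log Real.pi) :=
    mul_le_mul_of_nonneg_left hκ (by linarith)
  have ht2' : 2 * t ^ 2 ≤ t := by nlinarith
  linarith

/-! ### The pivots: `d_M ≤ (log M + 4)/(M − 1)` -/

/-- **The leading term as a bound: `d_M ≤ (log M + 4)/(M − 1)`** for every `M ≥ 3` at which
`S_{M−1} = screwMatrix (M − 2)` is positive definite (`d_M ≤ 2Ψ(h_M)`, `h_M = log(M/(M−1)) ∈ [1/M, 1/(M−1)]`,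
and `two_zetaScrew_le_log`). [folklore] -/
theorem screwPivot_le_log_div (M : ℕ) (hM : 3 ≤ M) (h : (screwMatrix (M - 2)).PosDef) :
    screwPivot M ≤ (Real.log M + 4) / ((M : ℝ) - 1) := by
  have hM' : (3 : ℝ) ≤ (M : ℝ) := by exact_mod_cast hM
  have hM1 : (0 : ℝ) < (M : ℝ) - 1 := by linarith
  set x : ℝ := (M : ℝ) / ((M : ℝ) - 1) with hx
  have hx_pos : 0 < x := by positivity
  have hx1 : x - 1 = 1 / ((M : ℝ) - 1) := by rw [hx]; field_simp; ring
  have hxinv : 1 - x⁻¹ = 1 / (M : ℝ) := by rw [hx]; field_simp; ring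
  set hh : ℝ := Real.log x with hhdef
  have hh_le : hh ≤ 1 / ((M : ℝ) - 1) := by rw [hhdef, ← hx1]; exact Real.log_le_sub_one_of_pos hx_pos
  have hh_ge : 1 / (M : ℝ) ≤ hh := by rw [hhdef, ← hxinv]; exact Real.one_sub_inv_le_log_of_pos hx_pos
  have hh_pos : 0 < hh := lt_of_lt_of_le (by positivity) hh_ge
  have hh_half : hh ≤ 1 / 2 := le_trans hh_le (by
    rw [div_le_div_iff_of_pos_left one_pos hM1 (by norm_num)]; linarith)
  have hpiv := screwPivot_le_two_zetaScrew_log_div M (by omega) h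
  have hΨ := two_zetaScrew_le_log hh_pos hh_half
  have hlog : Real.log (1 / hh) ≤ Real.log M := by
    apply Real.log_le_log (by positivity)
    rw [div_le_iff₀ hh_pos]
    have : 1 / (M : ℝ) * M = 1 := by field_simp
    nlinarith
  have hlogM : 0 ≤ Real.log (M : ℝ) := Real.log_nonneg (by linarith)
  have hlog0 : 0 ≤ Real.log (1 / hh) := Real.log_nonneg (by
    rw [le_div_iff₀ hh_pos]; linarith)
  calc screwPivot M ≤ 2 * zetaScrew (Real.log ((M : ℝ) / ((M : ℝ) - 1))) := hpiv
    _ = 2 * zetaScrew hh := by rw [hhdef, hx]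
    _ ≤ hh * Real.log (1 / hh) + 4 * hh := hΨ
    _ ≤ 1 / ((M : ℝ) - 1) * Real.log M + 4 * (1 / ((M : ℝ) - 1)) := by
        have := mul_le_mul hh_le hlog hlog0 (by positivity)
        linarith
    _ = (Real.log M + 4) / ((M : ℝ) - 1) := by field_simp

/-- Along a certified ladder (RH-free): if `d_2, …, d_{N+1} > 0` then `d_M ≤ (log M + 4)/(M − 1)` for every
`3 ≤ M ≤ N + 2`. [folklore] -/
theorem screwPivot_le_log_div_of_ladder (N : ℕ)
    (hlad : ∀ M : ℕ, 2 ≤ M → M ≤ N + 1 → 0 < screwPivot M) (M : ℕ) (hM : 3 ≤ M) (hMN : M ≤ N + 2) :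
    screwPivot M ≤ (Real.log M + 4) / ((M : ℝ) - 1) :=
  screwPivot_le_log_div M hM (screwMatrix_posDef_of_screwPivot_pos_le N hlad (M - 2) (by omega))

/-- Under RH, for every `M ≥ 3`: `0 < d_M ≤ (log M + 4)/(M − 1)` — the RH-equivalent positivity of the
pivots holds with a margin that tends to `0` at least like `log M / M`. [folklore] -/
theorem screwPivot_le_log_div_of_riemannHypothesis (hRH : _root_.RiemannHypothesis) (M : ℕ)
    (hM : 3 ≤ M) :
    0 < screwPivot M ∧ screwPivot M ≤ (Real.log M + 4) / ((M : ℝ) - 1) :=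
  ⟨screwPivot_pos_of_posDef (screwMatrix_posDef_of_riemannHypothesis hRH) M (by omega),
    screwPivot_le_log_div M hM (screwMatrix_posDef_of_riemannHypothesis hRH (M - 2))⟩

end Summit.RiemannHypothesis.RiemannHypothesis.Theorems.IntegerScrew
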